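import Summits.Ventures.LatticeQCDFlow.Scaling.CalibratedWindowSteps

/-!
# LatticeQCDFlow / Scaling — the CALIBRATED transport window laws (file 2 of 2): `#E·(log(A/a) + κ·log Lip T) ≥ (β-β₀)·(S(U) - ⟨S⟩_{β₀})` for every configuration `U`; constant-free under exact small-ball asymptotics; `U(1)`, `U(N)`, `SU(N)`

HONEST FRAMING: exact (Metropolis-corrected) sampling algorithms for lattice gauge theory; figures of merit are
autocorrelation/cost numbers at stated couplings and volumes; no continuum-physics claim.

Venture `LatticeQCDFlow` (cell pub-lqcd), topic `Scaling`, FANOUT row 29 (theory-2) — OUR WORK (THEORY-2.md §3.3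
v2.9, rows (C2a-W⁺) / (C2a-H⁺)).  Items and tools: `Scaling/CalibratedWindowSteps.lean` (file 1).  Notation as
there; `-N ≤ Re tr ρ ≤ N`, two-sided ball volumes `a·r^κ ≤ Haar(B̄(g,r)) ≤ A·r^κ` for `0 < r ≤ r₁` only.

* `calibratedCoolingWindow_of_ballVolumes` **(C2a-W⁺, COOLING, Lipschitz side, PROVED)**: `0 ≤ β₀ ≤ β`, exact
  `K`-Lipschitz `T_* μ_{β₀} = μ_β` ⟹ for EVERY configuration `U`,
  `(β - β₀)·(S(U) - ⟨S⟩_{β₀}) ≤ #E·(log(A/a) + κ·log K)`; at a maximiser of `S`: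
  `κ·log Lip(T) ≥ (β - β₀)·(S_max - ⟨S⟩_{β₀})/#E - log(A/a)` — the RATE is the mean plaquette deficit of the
  source measure (a measured number), not the unspecified `c = 3s₀/(4κd)` of `ExactTransportExpansionBetween`, and
  the constant is `log(A/a)` alone instead of `log(A/a) + log(1/a) + κ·log(1/r₀)`;
* `calibratedHeatingWindow_of_ballVolumes` **(C2a-H⁺, HEATING, co-Lipschitz side, PROVED)**: `0 ≤ β ≤ β₀`, exact
  `K'`-co-Lipschitz `T_* μ_{β₀} = μ_β` ⟹ `(β₀ - β)·(S(U) - ⟨S⟩_β) ≤ #E·(log(A/a) + κ·log K')` for every `U`;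
* `calibratedCoolingWindow_of_smallBallAsymptotics`, `calibratedHeatingWindow_of_smallBallAsymptotics`
  **(constant-free forms)**: under `SmallBallAsymptotics G κ` the constant drops out —
  `(β - β₀)·(S(U) - ⟨S⟩_{β₀}) ≤ κ·#E·log Lip(T)` and `(β₀ - β)·(S(U) - ⟨S⟩_β) ≤ κ·#E·log coLip(T)`: the sharp
  metric-measure form of `h(TX) ≤ h(X) + dim·log Lip T` read between two Gibbs measures of one action;
* no hypothesis left: `U1.calibratedCoolingWindow d`, `U1.calibratedHeatingWindow d` (`G = U(1)`, chordal metric,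
  `κ = 1`, constant `log(π/2)` from the tree's `r/π ≤ Haar(B̄(g,r)) ≤ r/2`), `UN.calibratedWindow d N` (`κ = N²`),
  `SUN.calibratedWindow d N` (`κ = N² - 1`; `SU(3)`, `d = 4` included; the constant is the tree's Hilbert–Schmidt
  ball-volume ratio, independent of `L`, `β₀`, `β`).

Mechanism: STEP 1″ at a point whose image is `η`-close to `S_max` (`exists_apply_mem_of_map_eq_between`), resp.
STEP 2″ at a maximiser, and JENSEN for the `Z`-ratio, `(β₀ - β)·⟨S⟩_{β₀} ≤ log Z_β - log Z_{β₀}`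
(`mean_action_le_wilson`, `Scaling/LatticeGibbs.lean`).  One-plaquette reading (`U(1)`, `S = 1 - cos θ`,
`Z_β = e^{-β}·I₀(β)`): STEP 1″ with the EXACT `Z`-ratio gives `log Lip ≥ 2(β - β₀) - ∫_{β₀}^{β} ⟨S⟩_t dt
= (β - β₀) + log(I₀(β)/I₀(β₀))`, the calibrated law gives `log Lip ≥ (β - β₀)·(2 - ⟨S⟩_{β₀})
= (β - β₀)·(1 + I₁(β₀)/I₀(β₀))`; the difference is the Jensen gap `∫_{β₀}^{β} (⟨S⟩_{β₀} - ⟨S⟩_t) dt ≥ 0`, of second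
order in the window.  Elementary given the tree; nothing here is cited as a fact.
-/

noncomputable section

namespace Summit.Ventures.LatticeQCDFlow.Theory2.Lattice

open MeasureTheory Metric Set Literature.MathematicalPhysics.QuantumFieldTheory

/-! ## §2. The calibrated window laws (constants `log(A/a)`), cooling and heating -/

section Laws

variable {N : ℕ} {G : Type} [Group G] [MetricSpace G] [IsTopologicalGroup G] [CompactSpace G]
  [SecondCountableTopology G] [MeasurableSpace G] [BorelSpace G]
  (ρ : G →* Matrix (Fin N) (Fin N) ℂ)

/-- **(C2a-W⁺) THE CALIBRATED COOLING WINDOW LAW, PROVED** (OURS): local two-sided ball volumes with exponent `κ`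
below a radius `r₁ > 0`, a continuous `ρ` with `-N ≤ Re tr ρ ≤ N` ⟹ `CalibratedCoolingWindow d N G ρ κ (log(A/a))`:
for every exact `K`-Lipschitz `T_* μ_{Λ,β₀} = μ_{Λ,β}`, `0 ≤ β₀ ≤ β`, and every configuration `U`,
`(β - β₀)·(S(U) - ⟨S⟩_{β₀}) ≤ #E·(log(A/a) + κ·log K)`.  Proof: STEP 1″ at a point whose image is `η`-close to the
maximum of `S` (`exists_apply_mem_of_map_eq_between`), Jensen `(β₀ - β)·⟨S⟩_{β₀} ≤ log Z_β - log Z_{β₀}`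
(`mean_action_le_wilson`), `η → 0`. [folklore] -/
theorem calibratedCoolingWindow_of_ballVolumes (d : ℕ)
    (hρ : Continuous (ρ : G → Matrix (Fin N) (Fin N) ℂ))
    (htr : ∀ g, (ρ g).trace.re ≤ N) (htr' : ∀ g, -(N : ℝ) ≤ (ρ g).trace.re)
    {κ : ℕ} {a A r₁ : ℝ} (ha : 0 < a) (hA : 0 < A) (hr₁ : 0 < r₁)
    (hlo : ∀ (g : G) (r : ℝ), 0 < r → r ≤ r₁ → a * r ^ κ ≤ (haarProbability G (closedBall g r)).toReal)
    (hup : ∀ (g : G) (r : ℝ), 0 < r → r ≤ r₁ → (haarProbability G (closedBall g r)).toReal ≤ A * r ^ κ) :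
    CalibratedCoolingWindow d N G ρ κ (Real.log (A / a)) := by
  intro L _ β₀ β hβ₀ hβ T K hK0 hT hmap U
  have hβ0 : 0 ≤ β := hβ₀.trans hβ
  set S : GaugeConfig d L G → ℝ := wilsonAction (d := d) (L := L) ρ with hSdef
  have hScont : Continuous S := continuous_wilsonAction (d := d) (L := L) ρ hρ
  have hTm : Measurable T := hT.continuous.measurable
  obtain ⟨xM, -, hxM⟩ :=
    isCompact_univ.exists_isMaxOn univ_nonempty (hScont.continuousOn (s := (univ : Set (GaugeConfig d L G))))
  have hSmax : ∀ V, S V ≤ S xM := fun V => (isMaxOn_iff.1 hxM) V (mem_univ V)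
  have hJ := mean_action_le_wilson (d := d) (L := L) ρ hρ htr β₀ β hβ₀ hβ0
  have hmain : (β - β₀) * (S xM - wilsonExpectation (d := d) (L := L) ρ β₀ (wilsonAction (d := d) (L := L) ρ)) ≤
      Fintype.card (Edge d L) * (Real.log (A / a) + κ * Real.log (K : ℝ)) := by
    refine le_of_forall_pos_le_add fun ε hε => ?_
    have hθ : 0 < ε / (β + 1) := by positivity
    have hβθ : β * (ε / (β + 1)) ≤ ε := by
      rw [mul_div_assoc', div_le_iff₀ (by positivity)]; nlinarith
    obtain ⟨x, hx⟩ := exists_apply_mem_of_map_eq_between ρ htr htr' hβ0 hTm hmap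
      (isOpen_lt continuous_const hScont : IsOpen {U | S xM - ε / (β + 1) < S U})
      ⟨xM, by show S xM - ε / (β + 1) < S xM; linarith⟩
    have hx' : S xM - ε / (β + 1) < S (T x) := hx
    have h1 := log_partitionFunction_add_le_between_local ρ hρ htr ha hA hr₁ hlo hup hβ₀ hβ0 hK0 hT hmap x
    have hp1 : β * (S xM - ε / (β + 1)) ≤ β * S (T x) := mul_le_mul_of_nonneg_left hx'.le hβ0
    have hp2 : β₀ * S x ≤ β₀ * S xM := mul_le_mul_of_nonneg_left (hSmax x) hβ₀
    linarith [h1, hJ, hp1, hp2, hβθ]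
  have hU : (β - β₀) * (S U - wilsonExpectation (d := d) (L := L) ρ β₀ (wilsonAction (d := d) (L := L) ρ)) ≤
      (β - β₀) * (S xM - wilsonExpectation (d := d) (L := L) ρ β₀ (wilsonAction (d := d) (L := L) ρ)) :=
    mul_le_mul_of_nonneg_left (sub_le_sub_right (hSmax U) _) (sub_nonneg.2 hβ)
  exact hU.trans hmain

/-- **(C2a-H⁺) THE CALIBRATED HEATING WINDOW LAW, PROVED** (OURS): local two-sided ball volumes with exponent `κ`
below a radius `r₁ > 0`, a continuous `ρ` with `Re tr ρ ≤ N` ⟹ `CalibratedHeatingWindow d N G ρ κ (log(A/a))`: for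
every exact `K'`-co-Lipschitz `T_* μ_{Λ,β₀} = μ_{Λ,β}`, `0 ≤ β ≤ β₀`, and every configuration `U`,
`(β₀ - β)·(S(U) - ⟨S⟩_β) ≤ #E·(log(A/a) + κ·log K')`.  Proof: STEP 2″ at a maximiser of `S` plus Jensen
`(β - β₀)·⟨S⟩_β ≤ log Z_{β₀} - log Z_β`; no limiting argument. [folklore] -/
theorem calibratedHeatingWindow_of_ballVolumes (d : ℕ)
    (hρ : Continuous (ρ : G → Matrix (Fin N) (Fin N) ℂ)) (htr : ∀ g, (ρ g).trace.re ≤ N)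
    {κ : ℕ} {a A r₁ : ℝ} (ha : 0 < a) (hA : 0 < A) (hr₁ : 0 < r₁)
    (hlo : ∀ (g : G) (r : ℝ), 0 < r → r ≤ r₁ → a * r ^ κ ≤ (haarProbability G (closedBall g r)).toReal)
    (hup : ∀ (g : G) (r : ℝ), 0 < r → r ≤ r₁ → (haarProbability G (closedBall g r)).toReal ≤ A * r ^ κ) :
    CalibratedHeatingWindow d N G ρ κ (Real.log (A / a)) := by
  intro L _ β β₀ hβ hββ₀ T K' hK'0 hT' hmap U
  have hβ₀ : 0 ≤ β₀ := hβ.trans hββ₀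
  set S : GaugeConfig d L G → ℝ := wilsonAction (d := d) (L := L) ρ with hSdef
  have hScont : Continuous S := continuous_wilsonAction (d := d) (L := L) ρ hρ
  obtain ⟨xM, -, hxM⟩ :=
    isCompact_univ.exists_isMaxOn univ_nonempty (hScont.continuousOn (s := (univ : Set (GaugeConfig d L G))))
  have hSmax : ∀ V, S V ≤ S xM := fun V => (isMaxOn_iff.1 hxM) V (mem_univ V)
  have hJ := mean_action_le_wilson (d := d) (L := L) ρ hρ htr β β₀ hβ hβ₀
  have h1 := neg_log_partitionFunction_sub_le_between_local ρ hρ htr ha hA hr₁ hlo hup hβ₀ hβ hK'0 hT' hmap xM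
  have hp1 : β * S (T xM) ≤ β * S xM := mul_le_mul_of_nonneg_left (hSmax _) hβ
  have hmain : (β₀ - β) * (S xM - wilsonExpectation (d := d) (L := L) ρ β (wilsonAction (d := d) (L := L) ρ)) ≤
      Fintype.card (Edge d L) * (Real.log (A / a) + κ * Real.log (K' : ℝ)) := by
    linarith [h1, hJ, hp1]
  have hU : (β₀ - β) * (S U - wilsonExpectation (d := d) (L := L) ρ β (wilsonAction (d := d) (L := L) ρ)) ≤
      (β₀ - β) * (S xM - wilsonExpectation (d := d) (L := L) ρ β (wilsonAction (d := d) (L := L) ρ)) :=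
    mul_le_mul_of_nonneg_left (sub_le_sub_right (hSmax U) _) (sub_nonneg.2 hββ₀)
  exact hU.trans hmain

/-! ## §3. The constant-free forms under exact small-ball asymptotics -/

omit [SecondCountableTopology G] in
/-- From `SmallBallAsymptotics`: for every `η > 0` local two-sided ball volumes with `log(A/a) ≤ η`. [folklore] -/
theorem SmallBallAsymptotics.exists_ballVolumes {κ : ℕ} (hG : SmallBallAsymptotics G κ) {η : ℝ} (hη : 0 < η) :
    ∃ r₁ a A : ℝ, 0 < r₁ ∧ 0 < a ∧ 0 < A ∧ Real.log (A / a) ≤ η ∧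
      (∀ (g : G) (r : ℝ), 0 < r → r ≤ r₁ → a * r ^ κ ≤ (haarProbability G (closedBall g r)).toReal) ∧
      (∀ (g : G) (r : ℝ), 0 < r → r ≤ r₁ → (haarProbability G (closedBall g r)).toReal ≤ A * r ^ κ) := by
  obtain ⟨r₁, a, A, hr₁, ha, hAa, hballs⟩ := hG η hη
  have hb := hballs 1 r₁ hr₁ le_rfl
  have haA : a ≤ A := le_of_mul_le_mul_right (hb.1.trans hb.2) (pow_pos hr₁ κ)
  have hA : 0 < A := ha.trans_le haA
  refine ⟨r₁, a, A, hr₁, ha, hA, ?_, fun g r hr hr1 => (hballs g r hr hr1).1,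
    fun g r hr hr1 => (hballs g r hr hr1).2⟩
  rw [Real.log_div hA.ne' ha.ne']
  have h1 : Real.log A ≤ Real.log ((1 + η) * a) := Real.log_le_log hA hAa
  rw [Real.log_mul (by positivity) ha.ne'] at h1
  have h2 := Real.log_le_sub_one_of_pos (show 0 < 1 + η by positivity)
  linarith

/-- **(C2a-W⁺, constant-free) THE SHARP COOLING WINDOW LAW** (OURS): exact small-ball asymptotics with exponent
`κ`, a continuous `ρ` with `-N ≤ Re tr ρ ≤ N` ⟹ `CalibratedCoolingWindow d N G ρ κ 0`: for every exact
`K`-Lipschitz `T_* μ_{Λ,β₀} = μ_{Λ,β}`, `0 ≤ β₀ ≤ β`, every volume and every configuration `U`,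
`(β - β₀)·(S(U) - ⟨S⟩_{Λ,β₀}) ≤ κ·#E·log Lip(T)` — i.e. `log Lip(T) ≥ (β-β₀)·(S_max - ⟨S⟩_{β₀})/(κ·#E)` with NO
additive constant. [folklore] -/
theorem calibratedCoolingWindow_of_smallBallAsymptotics (d : ℕ)
    (hρ : Continuous (ρ : G → Matrix (Fin N) (Fin N) ℂ))
    (htr : ∀ g, (ρ g).trace.re ≤ N) (htr' : ∀ g, -(N : ℝ) ≤ (ρ g).trace.re)
    {κ : ℕ} (hG : SmallBallAsymptotics G κ) :
    CalibratedCoolingWindow d N G ρ κ 0 := by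
  intro L _ β₀ β hβ₀ hβ T K hK0 hT hmap U
  rw [zero_add]
  refine le_of_forall_pos_le_add fun η hη => ?_
  have hη' : 0 < η / ((Fintype.card (Edge d L) : ℝ) + 1) := by positivity
  obtain ⟨r₁, a, A, hr₁, ha, hA, hlog, hlo, hup⟩ := hG.exists_ballVolumes hη'
  have hW := calibratedCoolingWindow_of_ballVolumes ρ d hρ htr htr' ha hA hr₁ hlo hup L β₀ β hβ₀ hβ T K hK0 hT
    hmap U
  have hnE : (0 : ℝ) ≤ Fintype.card (Edge d L) := Nat.cast_nonneg _
  have hc : (Fintype.card (Edge d L) : ℝ) * Real.log (A / a) ≤ η :=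
    calc (Fintype.card (Edge d L) : ℝ) * Real.log (A / a)
        ≤ Fintype.card (Edge d L) * (η / ((Fintype.card (Edge d L) : ℝ) + 1)) := mul_le_mul_of_nonneg_left hlog hnE
      _ ≤ η := by rw [mul_div_assoc', div_le_iff₀ (by positivity)]; nlinarith
  linarith [hW, hc]

/-- **(C2a-H⁺, constant-free) THE SHARP HEATING WINDOW LAW** (OURS): exact small-ball asymptotics with exponent
`κ`, a continuous `ρ` with `Re tr ρ ≤ N` ⟹ `CalibratedHeatingWindow d N G ρ κ 0`: for every exact `K'`-co-Lipschitz
`T_* μ_{Λ,β₀} = μ_{Λ,β}`, `0 ≤ β ≤ β₀`, every volume and every `U`, `(β₀ - β)·(S(U) - ⟨S⟩_{Λ,β}) ≤ κ·#E·log K'`.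
[folklore] -/
theorem calibratedHeatingWindow_of_smallBallAsymptotics (d : ℕ)
    (hρ : Continuous (ρ : G → Matrix (Fin N) (Fin N) ℂ)) (htr : ∀ g, (ρ g).trace.re ≤ N)
    {κ : ℕ} (hG : SmallBallAsymptotics G κ) :
    CalibratedHeatingWindow d N G ρ κ 0 := by
  intro L _ β β₀ hβ hββ₀ T K' hK'0 hT' hmap U
  rw [zero_add]
  refine le_of_forall_pos_le_add fun η hη => ?_
  have hη' : 0 < η / ((Fintype.card (Edge d L) : ℝ) + 1) := by positivity
  obtain ⟨r₁, a, A, hr₁, ha, hA, hlog, hlo, hup⟩ := hG.exists_ballVolumes hη'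
  have hW := calibratedHeatingWindow_of_ballVolumes ρ d hρ htr ha hA hr₁ hlo hup L β β₀ hβ hββ₀ T K' hK'0 hT'
    hmap U
  have hnE : (0 : ℝ) ≤ Fintype.card (Edge d L) := Nat.cast_nonneg _
  have hc : (Fintype.card (Edge d L) : ℝ) * Real.log (A / a) ≤ η :=
    calc (Fintype.card (Edge d L) : ℝ) * Real.log (A / a)
        ≤ Fintype.card (Edge d L) * (η / ((Fintype.card (Edge d L) : ℝ) + 1)) := mul_le_mul_of_nonneg_left hlog hnE
      _ ≤ η := by rw [mul_div_assoc', div_le_iff₀ (by positivity)]; nlinarith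
  linarith [hW, hc]

end Laws

/-! ## §4. Instances with no hypothesis left: `U(1)` (explicit constant `log(π/2)`), `U(N)`, `SU(N)` -/

section Instances

open scoped Matrix.Norms.Frobenius
open Literature.MathematicalPhysics.QuantumFieldTheory.UnitaryCayley (𝔾)
open Literature.MathematicalPhysics.QuantumLattice (u1Rep continuous_u1Rep unitaryFundamentalRep
  continuous_unitaryFundamentalRep fundamentalRep continuous_fundamentalRep)

/-- **(C2a-W⁺) for `U(1) = Circle`, chordal metric, every `d`** (OURS): for every exact `K`-Lipschitz transport of
the `U(1)` Wilson law at `β₀ ≥ 0` onto the one at `β ≥ β₀`, every `L` and every configuration `U`,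
`(β - β₀)·(S(U) - ⟨S⟩_{β₀}) ≤ #E·(log(π/2) + log K)` (`κ = 1`; `Haar(B̄(g,r)) ∈ [r/π, r/2]`).  For `d = 2` and a
maximal-action `U` (all plaquettes `-1`, `L` even): `log Lip(T) ≥ (β - β₀)·(1 - ⟨1 - cos θ_p⟩_{β₀}/2) - log(π/2)`.
[folklore] -/
theorem U1.calibratedCoolingWindow (d : ℕ) :
    CalibratedCoolingWindow d 1 Circle u1Rep 1 (Real.log (Real.pi / 2)) := by
  have h := calibratedCoolingWindow_of_ballVolumes u1Rep d continuous_u1Rep U1.re_trace_u1Rep_le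
    U1.neg_one_le_re_trace (κ := 1) (a := 1 / Real.pi) (A := 1 / 2) (r₁ := 1) (by positivity) (by norm_num)
    one_pos (fun g r hr hr1 => U1.haar_closedBall_ge g hr hr1) (fun g r hr _ => U1.haar_closedBall_le g hr)
  have hc : (1 / 2 : ℝ) / (1 / Real.pi) = Real.pi / 2 := by
    rw [div_div_eq_mul_div, div_one, one_div_mul_eq_div]
  rwa [hc] at h

/-- **(C2a-H⁺) for `U(1) = Circle`, chordal metric, every `d`** (OURS): for every exact `K'`-co-Lipschitz transport
of the `U(1)` Wilson law at `β₀` onto the one at `0 ≤ β ≤ β₀`, every `L` and every `U`,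
`(β₀ - β)·(S(U) - ⟨S⟩_β) ≤ #E·(log(π/2) + log K')`. [folklore] -/
theorem U1.calibratedHeatingWindow (d : ℕ) :
    CalibratedHeatingWindow d 1 Circle u1Rep 1 (Real.log (Real.pi / 2)) := by
  have h := calibratedHeatingWindow_of_ballVolumes u1Rep d continuous_u1Rep U1.re_trace_u1Rep_le
    (κ := 1) (a := 1 / Real.pi) (A := 1 / 2) (r₁ := 1) (by positivity) (by norm_num)
    one_pos (fun g r hr hr1 => U1.haar_closedBall_ge g hr hr1) (fun g r hr _ => U1.haar_closedBall_le g hr)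
  have hc : (1 / 2 : ℝ) / (1 / Real.pi) = Real.pi / 2 := by
    rw [div_div_eq_mul_div, div_one, one_div_mul_eq_div]
  rwa [hc] at h

/-- **(C2a-W⁺)/(C2a-H⁺) for `U(N)`, Hilbert–Schmidt metric, every `N`, `d`** (OURS): there is a constant `C`
(the tree's ball-volume ratio `log(A/a)` of `U(N)`, independent of `L`, `β₀`, `β`) with
`CalibratedCoolingWindow d N U(N) ρ_fund N² C` and `CalibratedHeatingWindow d N U(N) ρ_fund N² C`. [folklore] -/
theorem UN.calibratedWindow (d N : ℕ) :
    ∃ C : ℝ,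
      @CalibratedCoolingWindow d N (𝔾 N) _ Subtype.metricSpace UN.isTopologicalGroup_hs UN.compactSpace_hs _
          UN.borelSpace_hs (unitaryFundamentalRep (Fin N) ℂ) (N * N) C ∧
        @CalibratedHeatingWindow d N (𝔾 N) _ Subtype.metricSpace UN.isTopologicalGroup_hs UN.compactSpace_hs _
          UN.borelSpace_hs (unitaryFundamentalRep (Fin N) ℂ) (N * N) C := by
  obtain ⟨a, ha, hlo⟩ := UN.haar_closedBall_ge (N := N)
  obtain ⟨A, hA, hup⟩ := UN.haar_closedBall_le (N := N)
  exact ⟨Real.log (A / a),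
    @calibratedCoolingWindow_of_ballVolumes N (𝔾 N) _ Subtype.metricSpace UN.isTopologicalGroup_hs
      UN.compactSpace_hs UN.secondCountable_hs _ UN.borelSpace_hs (unitaryFundamentalRep (Fin N) ℂ) d
      (continuous_unitaryFundamentalRep (Fin N) ℂ) UN.re_trace_le UN.neg_le_re_trace (N * N) a A 1 ha hA one_pos
      (fun g r hr hr1 => hlo g r hr hr1) (fun g r hr _ => hup g r hr),
    @calibratedHeatingWindow_of_ballVolumes N (𝔾 N) _ Subtype.metricSpace UN.isTopologicalGroup_hs
      UN.compactSpace_hs UN.secondCountable_hs _ UN.borelSpace_hs (unitaryFundamentalRep (Fin N) ℂ) d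
      (continuous_unitaryFundamentalRep (Fin N) ℂ) UN.re_trace_le (N * N) a A 1 ha hA one_pos
      (fun g r hr hr1 => hlo g r hr hr1) (fun g r hr _ => hup g r hr)⟩

/-- **(C2a-W⁺)/(C2a-H⁺) for `SU(N)`, `N ≥ 1`, Hilbert–Schmidt metric, every `d`** (OURS; `SU(3)`, `d = 4`
included): there is a constant `C` (the tree's ball-volume ratio of `SU(N)`) with
`CalibratedCoolingWindow d N SU(N) ρ_fund (N²-1) C` and `CalibratedHeatingWindow d N SU(N) ρ_fund (N²-1) C`.
Reading at `N = 3`, `d = 4`, `U` of maximal action: `8·(C + 8·log Lip T) ≥ (β - β₀)·(S_max - ⟨S⟩_{β₀})/L^4`.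
[folklore] -/
theorem SUN.calibratedWindow (d N : ℕ) (hN : 1 ≤ N) :
    ∃ C : ℝ,
      @CalibratedCoolingWindow d N (Matrix.specialUnitaryGroup (Fin N) ℂ) _ Subtype.metricSpace
          SUN.isTopologicalGroup_hs SUN.compactSpace_hs _ SUN.borelSpace_hs (fundamentalRep (Fin N)) (N * N - 1) C ∧
        @CalibratedHeatingWindow d N (Matrix.specialUnitaryGroup (Fin N) ℂ) _ Subtype.metricSpace
          SUN.isTopologicalGroup_hs SUN.compactSpace_hs _ SUN.borelSpace_hs (fundamentalRep (Fin N)) (N * N - 1) C := by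
  haveI : NeZero N := ⟨by omega⟩
  obtain ⟨a, ha, hlo⟩ := SUN.haar_closedBall_ge (N := N)
  obtain ⟨A, hA, hup⟩ := SUN.haar_closedBall_le (N := N)
  exact ⟨Real.log (A / a),
    @calibratedCoolingWindow_of_ballVolumes N (Matrix.specialUnitaryGroup (Fin N) ℂ) _ Subtype.metricSpace
      SUN.isTopologicalGroup_hs SUN.compactSpace_hs SUN.secondCountable_hs _ SUN.borelSpace_hs
      (fundamentalRep (Fin N)) d (continuous_fundamentalRep (Fin N)) (SUN.re_trace_le N) SUN.neg_le_re_trace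
      (N * N - 1) a A 1 ha hA one_pos (fun g r hr hr1 => hlo g r hr hr1) (fun g r hr _ => hup g r hr),
    @calibratedHeatingWindow_of_ballVolumes N (Matrix.specialUnitaryGroup (Fin N) ℂ) _ Subtype.metricSpace
      SUN.isTopologicalGroup_hs SUN.compactSpace_hs SUN.secondCountable_hs _ SUN.borelSpace_hs
      (fundamentalRep (Fin N)) d (continuous_fundamentalRep (Fin N)) (SUN.re_trace_le N)
      (N * N - 1) a A 1 ha hA one_pos (fun g r hr hr1 => hlo g r hr hr1) (fun g r hr _ => hup g r hr)⟩

end Instances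

end Summit.Ventures.LatticeQCDFlow.Theory2.Lattice
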